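import Mathlib
import HarnessLib
import Summits.HubbardSuperconductivity.HubbardSuperconductivity.Theorems.KLProgrammeSWaveCascadeArrayEdge
import Summits.HubbardSuperconductivity.HubbardSuperconductivity.Theorems.KLProgrammeKLRegimeSplitPairArrayEdge
import Summits.HubbardSuperconductivity.HubbardSuperconductivity.Theorems.KLProgrammeKLRegimeSplitSlotsV17F2

/-!
# Route `KLProgramme` — crux K3 gen 8, CHILD 1 `KLRegimeBetaSplitV17F2` (stmt-HubbardSuperconductivity-20438): row 0′ on the CROSS-FRAME carrier of the
# flowing-dispersion scheme F-II — the envelope of the pair amplitudes `𝒞_n[K_n](Qm; k, k′)` read at the flow frames `K_n = klFlowFrameU … n` on the ONE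
# bare-frame ball `klBall L μ 0`, from (E2-F2)-shaped signed ladder steps against the BARE-truncated array `klPairArrayF … (n−1)` and (E2″-F)-shaped increments

Cell gate-hubbard-kl, seat hubbard-kl-k3c1-p1 (g8; child-1 lineage; technique «composed-map remainder propagation»).  Context: K3-FLOW ruling F (KL STATUS
2026-08-27T10:17Z), gen-8 re-key rev 22 on the CURED bundle `klPredsV17F2` (`…SplitSlotsV17F2`, p527694: the (E2-F2) clause resums the bare-truncated array
`klPairArrayF`, one reading ball — k3c2-p2's cure 1); k3c1-p2's port recipe CHILD1-FLOW-PORT.md §4 (evidence #32/#35 on stmt-…-20236): the closed child-1 chain uses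
the common frame `K` in the CARRIER only through ONE matrix sequence on ONE ball, so on the flowing family it re-runs on the sequence
`j ↦ 𝒞_j[K_j]` truncated to `klBall L μ 0` — which is `klPairArrayF … j` BY DEFINITION.  This file is that instance of the carrier-generic row 0′
`SWaveCascade.amplitudeArray_envelope_edge` (p485689), token for token the twin of `wickPairArray_envelope_edge` (p485962) / `pairArray_envelope_edge` (p473743):
**`flowPairArray_envelope_edge`** — hypotheses in the (E2-F2)/(E2″-F) clause SHAPES (UV deviation `initDevBar + X₀` at `K_0`; in-class signed steps with
`Σ|w| ≤ bhi`, `Σ(|w| − w) ≤ δ_j(Qm)`, right inverse of `1 + diag(w)·klPairArrayF … (j−1) Qm`, bound `drivePBar + eremBar + X_j`; increments `gainBar + eremBar + X_j`,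
all read on `klBall L μ 0`), the negative-mass line at every in-class scale and the no-onset smallness; conclusion `∃ u ∈ [0, (16/15)·U]`,
`‖𝒞_n[K_n](Qm;k,k′) − u‖ ≤ 12·((initDevBar + Σ(drivePBar+ē) + Xtot) + (Σ(drivePBar+ē) + Xsup)) + ((Klam U)²·3CF + Xtot + Σē)` on the bare ball — the SAME numbers as at a
fixed frame.  The frame-shift allowance `frameShiftBar` and the flowing slice count live in the extra family `X` (next files).  Nothing here asserts that the model's
amplitudes satisfy the hypotheses (that is the engine's (E2-F2)/(E2″-F) output); nothing asserts superconductivity.  Everything is proved; no definitions.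
-/

noncomputable section

namespace Summit.HubbardSuperconductivity.HubbardSuperconductivity.Theorems.KLRegimeSplit

set_option linter.dupNamespace false -- summit = problem name (single-conjunct summit), D-0017

open Finset Literature.MathematicalPhysics.QuantumLattice Literature.Probability.LatticeModels
open Summit.HubbardSuperconductivity.HubbardSuperconductivity.Theorems.KLProgrammeLegKernels
open Summit.HubbardSuperconductivity.HubbardSuperconductivity.Theorems.CooperChannelRiccatiFlow
open Summit.HubbardSuperconductivity.HubbardSuperconductivity.Theorems.SWaveCascade

section Model

variable (L M : ℕ) [NeZero L] [NeZero M]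

variable {G : GeoConsts} {P : SplitConsts} {Qc : EngConsts}

/-- **Row 0′ on the cross-frame carrier of scheme F-II, every total momentum.**  The statement of `pairArray_envelope_edge` with the amplitudes
`klPairAmplitude … (klFlowFrameU … j) j` in place of `klPairAmplitude … K j`, the ball `klBall L μ 0` in place of `klBall L μ K`, and the resummed array of the
ladder clause the bare-truncated `klPairArrayF … (j−1) Qm`; see the module docstring. -/
theorem flowPairArray_envelope_edge (hG : G.WF) (hP : P.WF) (hQc : Qc.WF) {β U μ : ℝ} (hU : 0 ≤ U)
    {n : ℕ} (X : ℕ → TorusSite 2 L → TorusSite 2 L → TorusSite 2 L → ℝ) {Xtot Xsup : ℝ}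
    (hX0 : ∀ j Qm k k', 0 ≤ X j Qm k k') (hXtot0 : 0 ≤ Xtot) (hXsup0 : 0 ≤ Xsup)
    (hXsup : ∀ j Qm k k', X j Qm k k' ≤ Xsup)
    (hXsum : ∀ (t : ℕ) (Qm k k' : TorusSite 2 L), ∑ j ∈ Ioc t n, X j Qm k k' ≤ Xtot)
    (hXtot : ∀ Qm k k' : TorusSite 2 L, X 0 Qm k k' + ∑ i ∈ range n, X (i + 1) Qm k k' ≤ Xtot)
    (δ : ℕ → TorusSite 2 L → ℝ)
    (hneg : ∀ Qm : TorusSite 2 L, ∀ t ≤ n, IsPairClassAt L Qm t → 16 * U * ∑ i ∈ range t, δ (i + 1) Qm ≤ 1)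
    (h0 : ∀ Qm : TorusSite 2 L, ∀ k ∈ klBall L μ 0, ∀ k' ∈ klBall L μ 0,
      ‖klPairAmplitude L M β U μ (klFlowFrameU L M β U μ 0) 0 Qm k k' - (U : ℂ)‖ ≤ initDevBar G U + X 0 Qm k k')
    (hsteps : ∀ j, 1 ≤ j → j ≤ n → ∀ Qm : TorusSite 2 L, IsPairClassAt L Qm j →
      ∃ w : TorusSite 2 L → ℝ, (∑ p, |w p| ≤ G.bhi) ∧ (∑ p, (|w p| - w p) ≤ δ j Qm) ∧
        ∃ N : Matrix (TorusSite 2 L) (TorusSite 2 L) ℂ,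
          (1 + Matrix.diagonal (fun p => (w p : ℂ)) * klPairArrayF L M β U μ (j - 1) Qm) * N = 1 ∧
          ∀ k ∈ klBall L μ 0, ∀ k' ∈ klBall L μ 0,
            ‖klPairAmplitude L M β U μ (klFlowFrameU L M β U μ j) j Qm k k' - (klPairArrayF L M β U μ (j - 1) Qm * N) k k'‖ ≤
              drivePBar G P U (j - 1) + eremBar G P Qc U β L (j - 1) + X j Qm k k')
    (hincr : ∀ j, 1 ≤ j → j ≤ n → ∀ Qm : TorusSite 2 L, ∀ k ∈ klBall L μ 0, ∀ k' ∈ klBall L μ 0,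
      ‖klPairAmplitude L M β U μ (klFlowFrameU L M β U μ j) j Qm k k' -
          klPairAmplitude L M β U μ (klFlowFrameU L M β U μ (j - 1)) (j - 1) Qm k k'‖ ≤
        gainBar G P U j (klTorusNorm L Qm) (klTorusNorm L (k - k')) (klTorusNorm L (k + k' - Qm)) +
          eremBar G P Qc U β L (j - 1) + X j Qm k k')
    (Qm : TorusSite 2 L)
    (hsmall : 8 * 42 * ((initDevBar G U + ∑ j ∈ range n, (drivePBar G P U j + eremBar G P Qc U β L j) + Xtot) +
        (∑ j ∈ range n, (drivePBar G P U j + eremBar G P Qc U β L j) + Xsup)) * (G.bhi * n) ≤ 1) :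
    ∃ u : ℝ, 0 ≤ u ∧ u ≤ 16 / 15 * U ∧ ∀ k ∈ klBall L μ 0, ∀ k' ∈ klBall L μ 0,
      ‖klPairAmplitude L M β U μ (klFlowFrameU L M β U μ n) n Qm k k' - (u : ℂ)‖ ≤
        12 * ((initDevBar G U + ∑ j ∈ range n, (drivePBar G P U j + eremBar G P Qc U β L j) + Xtot) +
          (∑ j ∈ range n, (drivePBar G P U j + eremBar G P Qc U β L j) + Xsup)) +
        ((P.Klam * U) ^ 2 * (3 * G.CF) + Xtot + ∑ i ∈ range n, eremBar G P Qc U β L i) := by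
  classical
  have hG' := hG
  obtain ⟨-, -, -, -, -, -, -, -, -, -, -, hpp0, hph0, hCF, hphsum, hppsum, -⟩ := hG'
  have hbhi : 0 ≤ G.bhi := hG.2.2.1.trans hG.2.2.2.1
  have hinit0 : 0 ≤ initDevBar G U := by
    unfold initDevBar
    refine mul_nonneg (add_nonneg (sum_nonneg fun χ _ => add_nonneg (hG.2.1 χ) (hG.1 χ)) zero_le_one) (sq_nonneg U)
  have hGtot0 : 0 ≤ (P.Klam * U) ^ 2 * (3 * G.CF) := by positivity
  -- the frozen-gain line past the class exit, from `G.WF`'s gain sums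
  have hg : ∀ t ≤ n, ¬ IsPairClassAt L Qm (t + 1) → ∀ k ∈ klBall L μ 0, ∀ k' ∈ klBall L μ 0,
      ∑ j ∈ Ioc t n, gainBar G P U j (klTorusNorm L Qm) (klTorusNorm L (k - k')) (klTorusNorm L (k + k' - Qm)) ≤
        (P.Klam * U) ^ 2 * (3 * G.CF) := by
    intro t _ hexit k _ k' _
    have hexit' : ((4 : ℝ) ^ (t + 1))⁻¹ < klTorusNorm L Qm := lt_of_not_ge hexit
    have h1 : ∑ j ∈ Ioc t n, G.ppGain j (klTorusNorm L Qm) ≤ G.CF := hppsum _ t n hexit'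
    have hsub : ∀ ρ : ℝ, ∑ j ∈ Ioc t n, G.phGain j ρ ≤ ∑ j ∈ range (n + 1), G.phGain j ρ := fun ρ =>
      sum_le_sum_of_subset_of_nonneg (fun j hj => by simp only [mem_Ioc] at hj; exact mem_range.2 (by omega)) fun j _ _ => hph0 j ρ
    have h2 : ∑ j ∈ Ioc t n, G.phGain j (klTorusNorm L (k - k')) ≤ G.CF :=
      (hsub _).trans (hphsum _ (n + 1) (torusSupNorm_nonneg _))
    have h3 : ∑ j ∈ Ioc t n, G.phGain j (klTorusNorm L (k + k' - Qm)) ≤ G.CF :=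
      (hsub _).trans (hphsum _ (n + 1) (torusSupNorm_nonneg _))
    simp only [gainBar, ← mul_sum, sum_add_distrib]
    nlinarith [h1, h2, h3, sq_nonneg (P.Klam * U)]
  exact amplitudeArray_envelope_edge (klBall L μ 0) (fun j => klPairAmplitude L M β U μ (klFlowFrameU L M β U μ j) j Qm) (IsPairClassAt L Qm)
    (fun h hjm => isPairClassAt_mono L h hjm) hU hbhi hinit0 hGtot0
    (fun j => drivePBar G P U j + eremBar G P Qc U β L j) (fun j => eremBar G P Qc U β L j)
    (fun j => add_nonneg (drivePBar_nonneg' hG U j) (eremBar_nonneg' hG hP hQc U β L j))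
    (fun j => eremBar_nonneg' hG hP hQc U β L j)
    (fun j k k' => gainBar G P U j (klTorusNorm L Qm) (klTorusNorm L (k - k')) (klTorusNorm L (k + k' - Qm)))
    (fun j => X j Qm) (fun j k k' => hX0 j Qm k k') hXtot0 hXsup0 (fun j k k' => hXsup j Qm k k') (fun t k k' => hXsum t Qm k k')
    (fun k k' => hXtot Qm k k') (fun j => δ j Qm) (hneg Qm) (h0 Qm)
    (fun j hj1 hjn hQj => hsteps j hj1 hjn Qm hQj) (fun j hj1 hjn k hk k' hk' => hincr j hj1 hjn Qm k hk k' hk') hg hsmall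

end Model

end Summit.HubbardSuperconductivity.HubbardSuperconductivity.Theorems.KLRegimeSplit

end
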